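import Literature.Computability.QuantumComplexity.RestBlockStates
import HarnessLib

/-!
# A circuit on a block acts branch by branch: Born weights conditioned on the other wires

Infrastructure (trunk `CryptoQuantFine` model of `QuantumCircuit.lean`) for quantum algorithms that
run a *given* circuit — here, in the discharge of
`Literature.Algebra.EuclideanLattices.usvp_of_dihedralCoset`, a solver of Regev's dihedral coset
problem — on one block of a larger register whose other wires hold an *entangled* superposition
(the "measured" garbage of Regev's routine, 2004, proof of Lemma 3.12, p. 14: "we measure the
last register and … the state collapses to …"; in a circuit model without intermediate
measurements this is the principle of deferred measurement, Nielsen–Chuang 2010, §4.4). Writing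
a state `ψ` of the whole register as `∑_y |y⟩_off ⊗ ψ_y` over the classical contents `y` of the
wires outside the block `E : Fin b ↪ Fin W`, with the **branches**
`ψ_y := fun z => ψ (extend E z y)` (states of the block), an operator `U` placed on the block acts
on each branch separately and the Born weights of the result add up over the branches:

* `extend_zero_eq_iff`, `extend_zero_apply_emb` — bookkeeping for the zero-block
  representatives `extend E 0 x` (on top of `RestBlockStates.lean`: `extend_extend`,
  `extend_eq_iff`, `AgreeOff`);
* `placeGate_mulVec_extend` — **`(1 ⊗ U) ψ` restricted to the branch `y` is `U ψ_y`**: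
  `((placeGate E U) ψ) (extend E u y) = (U ψ_y) u`;
* `sum_eq_sum_sum_extend` — regrouping a sum over the register by off-block content
  (representatives `y` with `y|_E = 0`) and block content;
* **`sum_ite_normSq_placeGate_mulVec`** — for every event `T`,
  `∑_{x ∈ T} |((1 ⊗ U) ψ)(x)|² = ∑_{y : y|_E = 0} ∑_{u : extend E u y ∈ T} |(U ψ_y)(u)|²`;
* `probEvent_smul`, **`sum_ite_normSq_placeGate_eq_sum_probEvent`** — when `U` is the matrix of
  a circuit `C` and `T` is a product event `T_off ∧ T_E`, this is
  `∑_{y : y|_E = 0, y ∈ T_off} probEvent C ψ_y T_E`, the mixture over the measured off-block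
  contents of the event probabilities of `C` on the (unnormalised) branches — the form in which a
  promise on `C` for each branch input is consumed.

No named fact is introduced.

## References

* M. A. Nielsen, I. L. Chuang, *Quantum Computation and Quantum Information*, CUP 2010, §2.2.5
  (Born rule), §2.2.8 (composite systems), §4.3 (`U` on a subset of the wires is `U ⊗ 1`), §4.4
  (principle of deferred measurement) [NielsenChuang2010].
* O. Regev, *Quantum computation and lattice problems*, SIAM J. Comput. 33 (2004) 738–760,
  proof of Lemma 3.12 (p. 14) [Regev2004].
-/

noncomputable section

namespace Literature.Computability.QuantumComplexity

open Cryptography Matrix Finset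

variable {G : QGateSet} {b W : ℕ}

/-! ### Bookkeeping for `Function.extend E z y` -/

/-- For a representative `y` with zero block, `extend E 0 x = y` iff `x` agrees with `y` off the
block. [folklore] -/
theorem extend_zero_eq_iff (E : Fin b ↪ Fin W) {y : QReg W} (hy : ∀ j, y (E j) = false) (x : QReg W) :
    Function.extend E (fun _ => false) x = y ↔ ∀ i, i ∉ Set.range E → x i = y i := by
  constructor
  · intro h i hi
    have := congrFun h i
    rwa [Function.extend_apply' _ _ _ (by rintro ⟨j, rfl⟩; exact hi ⟨j, rfl⟩)] at this
  · intro h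
    funext i
    by_cases hi : ∃ j, E j = i
    · obtain ⟨j, rfl⟩ := hi
      rw [E.injective.extend_apply, hy]
    · rw [Function.extend_apply' _ _ _ hi]
      exact h i (by rintro ⟨j, rfl⟩; exact hi ⟨j, rfl⟩)

/-- The zero-block representative of any register has zero block. [folklore] -/
theorem extend_zero_apply_emb (E : Fin b ↪ Fin W) (x : QReg W) (j : Fin b) :
    Function.extend E (fun _ => false) x (E j) = false :=
  E.injective.extend_apply _ _ j

/-! ### A placed operator acts on each branch -/

/-- **`(1 ⊗ U) ψ` on the branch `y` is `U ψ_y`**: the amplitude of `extend E u y` after applying `U`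
placed on the block `E` is the amplitude of `u` in `U` applied to the branch
`ψ_y = fun z => ψ (extend E z y)`. [cite: NielsenChuang2010, §4.3 (a gate on a subset of the wires is U ⊗ 1)] -/
theorem placeGate_mulVec_extend (E : Fin b ↪ Fin W) (U : Matrix (QReg b) (QReg b) ℂ) (ψ : QReg W → ℂ)
    (u : QReg b) (y : QReg W) :
    (placeGate E U *ᵥ ψ) (Function.extend E u y) = (U *ᵥ fun z => ψ (Function.extend E z y)) u := by
  rw [placeGate_mulVec_apply, Matrix.mulVec, dotProduct]
  refine Finset.sum_congr rfl fun z _ => ?_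
  rw [extend_comp_embedding, extend_extend E]

/-! ### Regrouping sums over the register by off-block content -/

/-- **Regrouping by off-block content.** A sum over all registers is the sum, over the
representatives `y` with zero block, of the sums over the block contents `u` of the summand at
`extend E u y`. [cite: NielsenChuang2010, §2.2.8 (composite systems: basis |y⟩|u⟩)] -/
theorem sum_eq_sum_sum_extend {M : Type*} [AddCommMonoid M] (E : Fin b ↪ Fin W) (f : QReg W → M) :
    (∑ x : QReg W, f x) =
      ∑ y : QReg W, if (∀ j, y (E j) = false) then ∑ u : QReg b, f (Function.extend E u y) else 0 := by
  classical
  -- insert the representative of `x`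
  have h1 : (∑ x : QReg W, f x) =
      ∑ x : QReg W, ∑ y : QReg W, if Function.extend E (fun _ => false) x = y then f x else 0 := by
    refine Finset.sum_congr rfl fun x _ => ?_
    rw [Finset.sum_ite_eq]
    simp
  rw [h1, Finset.sum_comm]
  refine Finset.sum_congr rfl fun y _ => ?_
  by_cases hy : ∀ j, y (E j) = false
  · rw [if_pos hy]
    have h2 : (∑ x : QReg W, if Function.extend E (fun _ => false) x = y then f x else 0) =
        ∑ x : QReg W, if (∀ i, i ∉ Set.range E → x i = y i) then f x else 0 :=
      Finset.sum_congr rfl fun x _ => by simp only [extend_zero_eq_iff E hy]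
    rw [h2, sum_ite_agree_eq_sum_extend]
  · rw [if_neg hy]
    refine Finset.sum_eq_zero fun x _ => ?_
    rw [if_neg]
    intro h
    apply hy
    intro j
    rw [← h]
    exact extend_zero_apply_emb E x j

/-! ### Born weights after a placed operator, branch by branch -/

/-- **Born weights of `(1 ⊗ U) ψ`, conditioned on the other wires.** For every event `T` on the
whole register,
`∑_{x ∈ T} |((placeGate E U) ψ)(x)|² = ∑_{y : y|_E = 0} ∑_{u : extend E u y ∈ T} |(U ψ_y)(u)|²`
with the branches `ψ_y = fun z => ψ (extend E z y)`. (Deferred measurement: measuring the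
off-block wires before or after `U` gives the same statistics.)
[cite: NielsenChuang2010, §4.4 (principle of deferred measurement)] -/
theorem sum_ite_normSq_placeGate_mulVec (E : Fin b ↪ Fin W) (U : Matrix (QReg b) (QReg b) ℂ) (ψ : QReg W → ℂ)
    (T : QReg W → Prop) [DecidablePred T] :
    (∑ x : QReg W, if T x then ‖(placeGate E U *ᵥ ψ) x‖ ^ 2 else 0) =
      ∑ y : QReg W, if (∀ j, y (E j) = false) then
        ∑ u : QReg b, (if T (Function.extend E u y) then
          ‖(U *ᵥ fun z => ψ (Function.extend E z y)) u‖ ^ 2 else 0) else 0 := by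
  rw [sum_eq_sum_sum_extend E]
  refine Finset.sum_congr rfl fun y _ => ?_
  split_ifs with hy
  · refine Finset.sum_congr rfl fun u _ => ?_
    rw [placeGate_mulVec_extend]
  · rfl

/-- Event probabilities scale with the squared norm of a scalar: `probEvent (c • ψ) = |c|² probEvent ψ`
(for unnormalised branches `ψ_y = c_y • φ_y` with unit `φ_y`). [cite: NielsenChuang2010, §2.2.5 (Born rule)] -/
theorem probEvent_smul {n : ℕ} (A : Language Bool) (C : QCircuit G n) (c : ℂ) (ψ : QReg n → ℂ) (T : Set (QReg n)) :
    C.probEvent A (c • ψ) T = ‖c‖ ^ 2 * C.probEvent A ψ T := by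
  classical
  unfold QCircuit.probEvent QCircuit.runOn
  rw [Matrix.mulVec_smul, Finset.mul_sum]
  refine Finset.sum_congr rfl fun y _ => ?_
  rw [Pi.smul_apply, smul_eq_mul, norm_mul, mul_pow]

/-- The event probability of a circuit as a filtered sum of squared amplitudes of `U ψ`
(unfolding, with a decidable predicate). [folklore] -/
theorem probEvent_eq_sum_ite {n : ℕ} (A : Language Bool) (C : QCircuit G n) (ψ : QReg n → ℂ)
    (T : QReg n → Prop) [DecidablePred T] :
    C.probEvent A ψ {u | T u} = ∑ u : QReg n, if T u then ‖(C.toMatrix A *ᵥ ψ) u‖ ^ 2 else 0 := by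
  classical
  unfold QCircuit.probEvent QCircuit.runOn
  rw [Finset.sum_filter]
  refine Finset.sum_congr rfl fun u _ => ?_
  simp only [Set.mem_setOf_eq]
  congr 1

/-- **Product events: the mixture of the branch probabilities.** If `U` is the matrix of the circuit
`C` (relative to the oracle `A`) and the event asks `T_off` of the off-block content and `T_E` of
the block content, then
`∑_{x : T_off (extend E 0 x) ∧ T_E (x|_E)} |((placeGate E U) ψ)(x)|² =
  ∑_{y : y|_E = 0, T_off y} probEvent C ψ_y {u | T_E u}`:
the probability of the joint event is the sum over the measured off-block contents `y ∈ T_off` of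
the event probabilities of `C` run on the (unnormalised) branches `ψ_y`.
[cite: NielsenChuang2010, §4.4 (principle of deferred measurement) and §2.2.8] -/
theorem sum_ite_normSq_placeGate_eq_sum_probEvent (A : Language Bool) (E : Fin b ↪ Fin W) (C : QCircuit G b)
    (ψ : QReg W → ℂ) (Toff : QReg W → Prop) [DecidablePred Toff] (TE : QReg b → Prop) [DecidablePred TE] :
    (∑ x : QReg W, if Toff (Function.extend E (fun _ => false) x) ∧ TE (x ∘ E) then
        ‖(placeGate E (C.toMatrix A) *ᵥ ψ) x‖ ^ 2 else 0) =
      ∑ y : QReg W, if (∀ j, y (E j) = false) ∧ Toff y then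
        C.probEvent A (fun z => ψ (Function.extend E z y)) {u | TE u} else 0 := by
  classical
  rw [sum_ite_normSq_placeGate_mulVec E (C.toMatrix A) ψ]
  refine Finset.sum_congr rfl fun y _ => ?_
  by_cases hy : ∀ j, y (E j) = false
  · rw [if_pos hy]
    by_cases hT : Toff y
    · rw [if_pos ⟨hy, hT⟩, probEvent_eq_sum_ite]
      refine Finset.sum_congr rfl fun u _ => ?_
      have e1 : Function.extend E (fun _ => false) (Function.extend E u y) = y := by
        rw [extend_extend E]
        exact (extend_zero_eq_iff E hy y).2 fun _ _ => rfl
      simp only [e1, extend_comp_embedding, hT, true_and]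
    · rw [if_neg (fun h => hT h.2)]
      refine Finset.sum_eq_zero fun u _ => ?_
      have e1 : Function.extend E (fun _ => false) (Function.extend E u y) = y := by
        rw [extend_extend E]
        exact (extend_zero_eq_iff E hy y).2 fun _ _ => rfl
      rw [if_neg]
      rw [e1]
      exact fun h => hT h.1
  · rw [if_neg hy, if_neg (fun h => hy h.1)]

end Literature.Computability.QuantumComplexity

end
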